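/-
  hsemireg-monad-4 g7 — (B3.2⁺)₀ SUB-MONAD RANK LAW (joint Hall), fibre-level kernel core.
  line stmt-HodgeConjecture-18881 Cruxes/BlochSeedDiscOne/Lines/birth.lean 814a6a70c14e831a stub_rung_pad4_seedAt —
  EVIDENCE on 18881, not a rung.  Pure linear algebra over a field; no geometry, no `sorry`, no new axioms.
  Nothing here is proved toward HC ∕ HC_CM ∕ HC_AV ∕ №4 ∕ 26512 ∕ 18881 ∕ H2.

  DICTIONARY (memo B3-TABLE-V2-monad4-g7.md §2).  A three-term box monad `A --i--> N --q--> C` on the PAD-4 anchor, restricted to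
  the fibre at one point x, is a monad of finite-dimensional vector spaces: `i(x)` injective, `q(x)` surjective, `q(x) ∘ i(x) = 0`,
  cohomology `E(x) = ker q(x) ⧸ im i(x)` of dimension `rank E = m(N) − m(A) − m(C)`.  For a set `U` of N-cells put
  `N_U` = the fibres of the cells in `U`, `A_{⊆U}` = the A-cells all of whose live arcs land in `U` (so `i(A_{⊆U}) ≤ N_U`),
  `C_{⊆U}` = the C-cells all of whose live arcs come from `U` (so the composite `N → C → C_{⊆U}` kills the complementary
  fibres `N_{Uᶜ}`).  Then `A_{⊆U} → N_U → C_{⊆U}` is again a monad (`subMonad_of_compl`) and its cohomology has dimension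
  `m(U) − m(A_{⊆U}) − m(C_{⊆U}) ≥ 0` (`subMonad_finrank_le`): the t-free JOINT HALL inequality (B3.2⁺)₀, necessary for the
  EXISTENCE of the monad at a single point — the h⁰-weighted inequality (B3.2⁺) of B3MonadCohomology.lean (`ClosureIneq`) is its
  level-t analogue for `IT₀`.  The tight case `m(A_Γ) = m(N(Γ))` forces `i(x)` to be an isomorphism on the block
  (`tightBlock_bijective`), which is the fibre half of the TIGHT-BLOCK LAW (B3.2♭) (the other half, `c₁(det) ≠ 0`, is pen).
-/
import Mathlib

namespace Summit.HodgeConjecture.HodgeConjecture.Cruxes.BlochSeedDiscOne.B3JointHall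

open Module LinearMap

variable {K : Type*} [Field K]
variable {A U C : Type*} [AddCommGroup A] [Module K A] [AddCommGroup U] [Module K U] [AddCommGroup C] [Module K C]

/-- (B3.2⁺)₀, fibre core: a monad of vector spaces `A --i'--> U --f--> C` (`i'` injective, `f` surjective, `f ∘ i' = 0`,
`U` finite-dimensional) has `dim A + dim C ≤ dim U`; the defect `dim U − dim A − dim C` is the dimension of its cohomology. -/
theorem subMonad_finrank_le [FiniteDimensional K U] (i' : A →ₗ[K] U) (f : U →ₗ[K] C)
    (hi : Function.Injective i') (hf : Function.Surjective f) (h : f.comp i' = 0) :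
    finrank K A + finrank K C ≤ finrank K U := by
  have hle : LinearMap.range i' ≤ LinearMap.ker f := by
    rintro _ ⟨a, rfl⟩
    have := LinearMap.congr_fun h a
    simpa using this
  have h1 : finrank K (LinearMap.range i') = finrank K A := LinearMap.finrank_range_of_inj hi
  have h2 : finrank K (LinearMap.range i') ≤ finrank K (LinearMap.ker f) := Submodule.finrank_mono hle
  have h3 : finrank K (LinearMap.range f) + finrank K (LinearMap.ker f) = finrank K U :=
    LinearMap.finrank_range_add_finrank_ker f
  have h4 : finrank K (LinearMap.range f) = finrank K C := by
    rw [LinearMap.range_eq_top.mpr hf, finrank_top]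
  omega

/-- The cohomology of the fibre monad has exactly the expected dimension `dim U − dim A − dim C`
(as a statement about `ker f ⧸ (range i' viewed inside ker f)` we only record the dimension count of `ker f` here). -/
theorem subMonad_finrank_ker_eq [FiniteDimensional K U] (f : U →ₗ[K] C) (hf : Function.Surjective f) :
    finrank K (LinearMap.ker f) + finrank K C = finrank K U := by
  have h3 := LinearMap.finrank_range_add_finrank_ker f
  rw [LinearMap.range_eq_top.mpr hf, finrank_top] at h3
  omega

variable {N C' : Type*} [AddCommGroup N] [Module K N] [AddCommGroup C'] [Module K C']

/-- Reduction from the global fibre monad to the sub-monad cut out by a set of N-cells: if `g : N → C'` (think `g = π ∘ q(x)`,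
`π` the projection onto the fibres of `C_{⊆U}`) is surjective and kills a complement `W` of `U`, then `g` restricted to `U`
is still surjective. -/
theorem surjective_domRestrict_of_isCompl (g : N →ₗ[K] C') (U W : Submodule K N) (hUW : IsCompl U W)
    (hW : W ≤ LinearMap.ker g) (hg : Function.Surjective g) :
    Function.Surjective (g.domRestrict U) := by
  intro y
  obtain ⟨x, rfl⟩ := hg y
  -- decompose x along U ⊕ W
  have hx : x ∈ U ⊔ W := by rw [hUW.sup_eq_top]; exact Submodule.mem_top
  obtain ⟨u, hu, w, hw, rfl⟩ := Submodule.mem_sup.mp hx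
  refine ⟨⟨u, hu⟩, ?_⟩
  have hw0 : g w = 0 := hW hw
  simp [LinearMap.domRestrict_apply, map_add, hw0]

/-- The sub-monad assembled: `i : A' → N` injective with image in `U`, `g : N → C'` surjective, `g ∘ i = 0`, `g` killing a
complement of `U`  ⟹  `dim A' + dim C' ≤ dim U`.  (Apply with `A' = A_{⊆U}`, `C' = C_{⊆U}`, `g = π_{C⊆U} ∘ q(x)`.) -/
theorem subMonad_of_compl [FiniteDimensional K N] (i : A →ₗ[K] N) (g : N →ₗ[K] C') (U W : Submodule K N)
    (hUW : IsCompl U W) (hi : Function.Injective i) (hiU : ∀ a, i a ∈ U) (hg : Function.Surjective g)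
    (hW : W ≤ LinearMap.ker g) (h : g.comp i = 0) :
    finrank K A + finrank K C' ≤ finrank K U := by
  -- corestrict i to U
  let i' : A →ₗ[K] U := LinearMap.codRestrict U i hiU
  have hi' : Function.Injective i' := by
    intro a b hab
    apply hi
    have := congrArg Subtype.val hab
    simpa [i'] using this
  have hf : Function.Surjective (g.domRestrict U) := surjective_domRestrict_of_isCompl g U W hUW hW hg
  have hcomp : (g.domRestrict U).comp i' = 0 := by
    ext a
    have := LinearMap.congr_fun h a
    simpa [i'] using this
  exact subMonad_finrank_le i' (g.domRestrict U) hi' hf hcomp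

/-- TIGHT-BLOCK LAW (B3.2♭), fibre half: on a tight block (`dim A_Γ = dim N(Γ)`) an injective `i(x)` is bijective, so the
block of `i` is an isomorphism of bundles of equal rank and its determinant is a nowhere-vanishing section of
`det N(Γ) ⊗ (det A_Γ)⁻¹` — whence `c₁ = δ(Γ) = 0` (pen; memo §2), i.e. only IDENTITY tight blocks survive. -/
theorem tightBlock_bijective [FiniteDimensional K U] (i' : A →ₗ[K] U) (hi : Function.Injective i')
    (htight : finrank K A = finrank K U) : Function.Bijective i' := by
  haveI : FiniteDimensional K A := Module.Finite.of_injective i' hi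
  exact ⟨hi, (LinearMap.injective_iff_surjective_of_finrank_eq_finrank htight).mp hi⟩

/-- Toy instance of (B3.2⁺)₀ failing although both one-sided Hall conditions hold: `A = C = U = K` with `i' = id`:
any `f` with `f ∘ id = 0` is `0`, hence not surjective — one N-copy cannot serve an A-copy and a C-copy at once
(`1 + 1 ≤ 1` is false). -/
example : ¬ (∃ f : K →ₗ[K] K, Function.Surjective f ∧ f.comp (LinearMap.id) = 0) := by
  rintro ⟨f, hf, h⟩
  have h0 : f = 0 := by simpa using h
  obtain ⟨x, hx⟩ := hf 1
  simp [h0] at hx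

end Summit.HodgeConjecture.HodgeConjecture.Cruxes.BlochSeedDiscOne.B3JointHall
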